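import Mathlib.Algebra.Order.Floor.Ring
import Mathlib.Algebra.Order.ToIntervalMod
import Mathlib.Topology.Algebra.Order.Floor
import Mathlib.MeasureTheory.Integral.IntervalIntegral.Basic
import Literature.Analysis.FunctionSpaces.TorusSpaceTime
import HarnessLib

/-!
# Periodisation in time of space–time fields on the torus; smooth time cutoffs

Analysis/FunctionSpaces support file for constructions that turn a solution living on a time
window into a *time-periodic* smooth field by cutting off in time and repeating the window
(Cheskidov, arXiv:2311.04182 (2023), §6, p. 18: "the density and the drift are defined as
`τ`-periodizations of their cutoffs, `θ^m(t) := ∑_{n ∈ ℤ} θ̃^m(t + τn) η(t + τn)`"). When the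
cut-off field vanishes near both ends of a window of length `τ`, the lattice sum has at most one
non-zero term at every time, and the periodisation is simply the composition with the *wrap map*
`t ↦ t - ⌊(t - a)/τ⌋ τ ∈ [a, a + τ)`; this is the form developed here (no infinite sums).

## Contents (all proved, [folklore] unless a source is named)

* `timeWrap a τ t = t - ⌊(t - a)/τ⌋ τ` — the wrap of `ℝ` onto the window `[a, a + τ)`. For
  `0 < τ` this IS Mathlib's `toIcoMod hτ a t` (`timeWrap_eq_toIcoMod`, via `toIcoDiv_eq_floor`);
  it is kept as a total function of `(a, τ, t)` (no positivity argument to thread through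
  `timePeriodize`, so that periodisations are plain functions usable under binders; junk for
  `τ ≤ 0`, see the docstring) and its window/periodicity lemmas are one-line transports of
  `toIcoMod_mem_Ico`, `toIcoMod_eq_iff`, `toIcoMod_eq_self`, `toIcoMod_add_right`,
  `toIcoMod_sub_zsmul`. New here: `range_timeWrap` and the local description
  `timeWrap_eventually_eq_or` (near every `t₀` the wrap is the translate by `⌊(t₀ - a)/τ⌋ τ`,
  except to the left of a seam where it is the translate landing near `a + τ`).
* `timePeriodize a τ w = w ∘ timeWrap a τ` for `w : ℝ → X` — periodic, equal to `w` on the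
  window, commuting with every slice-wise operation (`timePeriodize_comp`), `iSup` over all times
  = `iSup` over the window (`iSup_comp_timePeriodize`), period integrals unchanged
  (`intervalIntegral_comp_timePeriodize`).
* For space–time fields `w : ℝ → T^d → F` vanishing outside a compact sub-window
  `(b, c)`, `a ≤ b`, `c < a + τ`: near every time the periodisation is a time
  translate of `w` (`eventually_timePeriodize_eq_translate`), hence it is jointly smooth when `w`
  is (`Torus.IsSmoothSpaceTimeOn.timePeriodize`) and time derivatives commute with periodisation
  (`Torus.timeDerivWithin_timePeriodize`).
* Smooth time cutoffs: `Torus.IsSmoothSpaceTimeOn.cutoff` — if `u` is jointly smooth on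
  `S × T^d` and `χ ∈ C^∞(ℝ)` has `tsupport χ ⊆ interior S`, then `(t, x) ↦ χ(t) u(t, x)` is
  jointly smooth on all of `ℝ × T^d` (Cheskidov 2023, §6: `η θ̃^m`, `η̃ ṽ^m`).

Nearest prior art in Mathlib: the wrap is `toIcoMod` (`Mathlib.Algebra.Order.ToIntervalMod`,
`toIcoDiv_eq_floor`), with `continuousAt_toIcoMod` (continuity away from the seams) and
`continuousWithinAt_toIcoMod_Ici` (one-sided at a seam) in `Topology/Instances/AddCircle/Defs`;
and `AddCircle.liftIco p a f` composed with the quotient map `ℝ → AddCircle p` is exactly the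
periodisation of `f` from the window `[a, a + p)`, continuous when `f a = f (a + p)`
(`AddCircle.liftIco_continuous`). What Mathlib does not have, and this file adds, is the
eventual-translate description near every time for functions vanishing near both ends of the
window (`timeWrap_eventually_eq_or`, `eventually_timePeriodize_eq_translate`), from which joint
`C^∞` smoothness of periodised space–time fields and the commutation with `∂ₜ` follow, plus the
`iSup`/period-integral bookkeeping (searched `toIcoMod` + `ContDiff`/`deriv`, `liftIco` +
`ContDiff`: nothing).

## References

* A. Cheskidov, *Dissipation anomaly and anomalous dissipation in incompressible fluid flows*,
  arXiv:2311.04182 (2023), §6, p. 18 (cutoffs `η`, `η̃` and `τ`-periodisation).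
-/

open Set Filter Topology Function MeasureTheory
open scoped ContDiff

noncomputable section

namespace Literature.Analysis.FunctionSpaces

/-! ## The wrap map onto a window `[a, a + τ)` -/

section Wrap

variable {a τ : ℝ}

/-- The **wrap map** onto the window `[a, a + τ)`: `timeWrap a τ t = t - ⌊(t - a)/τ⌋ τ`, the
unique representative of `t` modulo `τℤ` in `[a, a + τ)` for `τ > 0`, where it coincides with
Mathlib's `toIcoMod hτ a t` (`timeWrap_eq_toIcoMod`). Kept total in `τ` so that no positivity
proof has to be threaded through `timePeriodize`; *junk for `τ ≤ 0`* (`τ = 0`: `⌊_/0⌋ = 0`, so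
`timeWrap a 0 = id`; `τ < 0`: a representative in `(a + τ, a]`), all lemmas assume `0 < τ`. [folklore] -/
def timeWrap (a τ t : ℝ) : ℝ := t - (⌊(t - a) / τ⌋ : ℝ) * τ

/-- Unfolding `timeWrap`. [folklore] -/
theorem timeWrap_def (a τ t : ℝ) : timeWrap a τ t = t - (⌊(t - a) / τ⌋ : ℝ) * τ := rfl

/-- **Bridge to Mathlib**: for `0 < τ`, `timeWrap a τ t = toIcoMod hτ a t`
(`toIcoDiv_eq_floor`). [folklore] -/
theorem timeWrap_eq_toIcoMod (hτ : 0 < τ) (a t : ℝ) : timeWrap a τ t = toIcoMod hτ a t := by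
  rw [toIcoMod, toIcoDiv_eq_floor, zsmul_eq_mul]
  rfl

/-- The wrap lands in the window: `timeWrap a τ t ∈ [a, a + τ)` (`τ > 0`; Mathlib
`toIcoMod_mem_Ico`). [folklore] -/
theorem timeWrap_mem_Ico (hτ : 0 < τ) (t : ℝ) : timeWrap a τ t ∈ Ico a (a + τ) := by
  rw [timeWrap_eq_toIcoMod hτ]
  exact toIcoMod_mem_Ico hτ a t

/-- The wrap as a translate: `timeWrap a τ t = t - n τ` exactly when `t - n τ ∈ [a, a + τ)`
(`τ > 0`; Mathlib `toIcoMod_eq_iff`). [folklore] -/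
theorem timeWrap_eq_sub_iff (hτ : 0 < τ) (t : ℝ) (n : ℤ) :
    timeWrap a τ t = t - n * τ ↔ t - n * τ ∈ Ico a (a + τ) := by
  rw [timeWrap_eq_toIcoMod hτ, toIcoMod_eq_iff hτ]
  constructor
  · exact fun h => h.1
  · exact fun h => ⟨h, n, by rw [zsmul_eq_mul]; ring⟩

/-- On the window the wrap is the identity (Mathlib `toIcoMod_eq_self`). [folklore] -/
theorem timeWrap_eq_self (hτ : 0 < τ) {t : ℝ} (ht : t ∈ Ico a (a + τ)) : timeWrap a τ t = t := by
  rw [timeWrap_eq_toIcoMod hτ]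
  exact (toIcoMod_eq_self hτ).2 ht

/-- The wrap is `τ`-periodic (Mathlib `toIcoMod_add_right`). [folklore] -/
theorem periodic_timeWrap (hτ : 0 < τ) : Periodic (timeWrap a τ) τ := fun t => by
  rw [timeWrap_eq_toIcoMod hτ, timeWrap_eq_toIcoMod hτ, toIcoMod_add_right]

/-- The wrap is `nτ`-periodic for every integer `n` (Mathlib `toIcoMod_sub_zsmul`). [folklore] -/
theorem timeWrap_sub_int_mul (hτ : 0 < τ) (t : ℝ) (n : ℤ) : timeWrap a τ (t - n * τ) = timeWrap a τ t := by
  rw [timeWrap_eq_toIcoMod hτ, timeWrap_eq_toIcoMod hτ, ← zsmul_eq_mul, toIcoMod_sub_zsmul]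

/-- The range of the wrap is the window `[a, a + τ)`. [folklore] -/
theorem range_timeWrap (hτ : 0 < τ) : range (timeWrap a τ) = Ico a (a + τ) := by
  refine Subset.antisymm (range_subset_iff.2 (timeWrap_mem_Ico hτ)) fun t ht => ?_
  exact ⟨t, timeWrap_eq_self hτ ht⟩

/-- **Local description of the wrap.** Near every `t₀` the wrap is the translate by
`n τ`, `n = ⌊(t₀ - a)/τ⌋`, except possibly to the left of `t₀` when `t₀` sits on a seam
(`timeWrap a τ t₀ = a`), where it is the translate by `(n - 1) τ`, landing in `(a + τ - ε, a + τ)`.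
Precisely: for `ε > 0`, eventually near `t₀`, either `timeWrap a τ t = t - n τ`, or
`timeWrap a τ t = t - (n - 1) τ` and `a + τ - ε < timeWrap a τ t` and `t - n τ < a`. [folklore] -/
theorem timeWrap_eventually_eq_or (hτ : 0 < τ) (t₀ : ℝ) {ε : ℝ} (hε : 0 < ε) :
    ∀ᶠ t in 𝓝 t₀,
      timeWrap a τ t = t - ⌊(t₀ - a) / τ⌋ * τ ∨
        (timeWrap a τ t = t - (⌊(t₀ - a) / τ⌋ - 1 : ℤ) * τ ∧ a + τ - ε < timeWrap a τ t ∧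
          t - ⌊(t₀ - a) / τ⌋ * τ < a) := by
  set n : ℤ := ⌊(t₀ - a) / τ⌋ with hn
  have h0 : timeWrap a τ t₀ = t₀ - n * τ := rfl
  have hmem := timeWrap_mem_Ico (a := a) hτ t₀
  rw [h0] at hmem
  -- `t - n τ` stays below `a + τ` and above `a + τ - ε - τ`... work with `s = t - n τ` near `s₀ ∈ [a, a+τ)`
  have h1 : ∀ᶠ t in 𝓝 t₀, t - n * τ < a + τ ∧ a - min ε τ < t - n * τ := by
    have hc : Tendsto (fun t : ℝ => t - n * τ) (𝓝 t₀) (𝓝 (t₀ - n * τ)) :=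
      (continuous_id.sub continuous_const).tendsto t₀
    refine (hc.eventually (Ioo_mem_nhds ?_ hmem.2)).mono fun t ht => ⟨ht.2, ht.1⟩
    have : 0 < min ε τ := lt_min hε hτ
    linarith [hmem.1]
  filter_upwards [h1] with t ht
  by_cases hta : a ≤ t - n * τ
  · exact Or.inl ((timeWrap_eq_sub_iff hτ t n).2 ⟨hta, ht.1⟩)
  · replace hta : t - n * τ < a := lt_of_not_ge hta
    refine Or.inr ⟨(timeWrap_eq_sub_iff hτ t (n - 1)).2 ⟨?_, ?_⟩, ?_, hta⟩
    · push_cast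
      have := min_le_right ε τ
      linarith [ht.2]
    · push_cast; linarith
    · rw [(timeWrap_eq_sub_iff hτ t (n - 1)).2 ⟨?_, ?_⟩]
      · push_cast
        have := min_le_left ε τ
        linarith [ht.2]
      · push_cast
        have := min_le_right ε τ
        linarith [ht.2]
      · push_cast; linarith

end Wrap

/-! ## Periodisation of functions of time -/

section Periodize

variable {X : Type*} {a τ : ℝ}

/-- **Periodisation from a window**: `timePeriodize a τ w t = w (timeWrap a τ t)`, the
`τ`-periodic function that agrees with `w` on `[a, a + τ)` (Cheskidov 2023, §6, p. 18: the
`τ`-periodisation `∑_{n ∈ ℤ} w(t + τn)` of a function supported in a window of length `< τ`,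
which has at most one non-zero term). [cite: Cheskidov2023, §6 p. 18] -/
def timePeriodize (a τ : ℝ) (w : ℝ → X) (t : ℝ) : X := w (timeWrap a τ t)

/-- Unfolding `timePeriodize`. [folklore] -/
theorem timePeriodize_apply (a τ : ℝ) (w : ℝ → X) (t : ℝ) :
    timePeriodize a τ w t = w (timeWrap a τ t) := rfl

/-- The periodisation is `τ`-periodic. [folklore] -/
theorem periodic_timePeriodize (hτ : 0 < τ) (w : ℝ → X) : Periodic (timePeriodize a τ w) τ :=
  fun t => by simp only [timePeriodize_apply, periodic_timeWrap hτ t]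

/-- On the window the periodisation is the original function. [folklore] -/
theorem timePeriodize_eq_self (hτ : 0 < τ) (w : ℝ → X) {t : ℝ} (ht : t ∈ Ico a (a + τ)) :
    timePeriodize a τ w t = w t := by
  rw [timePeriodize_apply, timeWrap_eq_self hτ ht]

/-- Periodisation commutes with every slice-wise operation `Φ`:
`timePeriodize a τ (Φ ∘ w) = Φ ∘ timePeriodize a τ w`. [folklore] -/
theorem timePeriodize_comp {Y : Type*} (Φ : X → Y) (w : ℝ → X) :
    timePeriodize a τ (Φ ∘ w) = Φ ∘ timePeriodize a τ w := rfl

/-- Pointwise form of `timePeriodize_comp` for dependent slice-wise operations. [folklore] -/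
theorem timePeriodize_comp_apply {Y : Type*} (Φ : X → Y) (w : ℝ → X) (t : ℝ) :
    timePeriodize a τ (fun s => Φ (w s)) t = Φ (timePeriodize a τ w t) := rfl

/-- **Suprema over all times are suprema over the window**: for `f` with values in a complete
lattice (e.g. `ℝ≥0∞`-valued norms), `⨆ t, f (timePeriodize a τ w t) = ⨆ t ∈ [a, a + τ), f (w t)`. [folklore] -/
theorem iSup_comp_timePeriodize {β : Type*} [CompleteLattice β] (hτ : 0 < τ) (w : ℝ → X) (f : X → β) :
    ⨆ t, f (timePeriodize a τ w t) = ⨆ t ∈ Ico a (a + τ), f (w t) := by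
  rw [← range_timeWrap (a := a) hτ, iSup_range]
  rfl

/-- **Period integrals are window integrals**: `∫_a^{a+τ} g(timePeriodize w t) dt = ∫_a^{a+τ} g(w t) dt`
(the two integrands agree on `[a, a + τ)`, hence a.e. on the interval). [folklore] -/
theorem intervalIntegral_comp_timePeriodize {E : Type*} [NormedAddCommGroup E] [NormedSpace ℝ E]
    (hτ : 0 < τ) (w : ℝ → X) (g : X → E) :
    ∫ t in a..a + τ, g (timePeriodize a τ w t) = ∫ t in a..a + τ, g (w t) := by
  refine intervalIntegral.integral_congr_ae ?_
  filter_upwards [(countable_singleton (a + τ)).ae_notMem volume] with t ht hmem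
  rw [uIoc_of_le (by linarith)] at hmem
  rw [timePeriodize_eq_self hτ w ⟨hmem.1.le, lt_of_le_of_ne hmem.2 ht⟩]

/-- **Near every time the periodisation of a field supported in a compact sub-window is a time
translate.** If `w t = 0` for `t ∉ (b, c)` with `a ≤ b`, `c < a + τ`, then for every `t₀`,
eventually near `t₀`, `timePeriodize a τ w t = w (t - n τ)` with `n = ⌊(t₀ - a)/τ⌋` (to the left
of a seam both sides vanish). [folklore] -/
theorem eventually_timePeriodize_eq_translate [Zero X] {b c : ℝ} {w : ℝ → X} (hτ : 0 < τ)
    (hab : a ≤ b) (hc : c < a + τ)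
    (hw : ∀ t, t ∉ Ioo b c → w t = 0) (t₀ : ℝ) :
    ∀ᶠ t in 𝓝 t₀, timePeriodize a τ w t = w (t - ⌊(t₀ - a) / τ⌋ * τ) := by
  have hε : 0 < a + τ - c := by linarith
  filter_upwards [timeWrap_eventually_eq_or (a := a) hτ t₀ hε] with t ht
  rcases ht with h | ⟨h1, h2, h3⟩
  · rw [timePeriodize_apply, h]
  · rw [timePeriodize_apply, hw _ fun hm => ?_, hw _ fun hm => ?_]
    · exact absurd hm.1 (by linarith)
    · have : c < timeWrap a τ t := by linarith
      exact absurd hm.2 (by linarith)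

/-- The periodisation of a field vanishing off `(b, c) ⊂ (a, a + τ)` agrees with it on the whole
closed window `[a, a + τ]` (at `a + τ` both vanish). [folklore] -/
theorem timePeriodize_eq_self_of_mem_Icc [Zero X] {b c : ℝ} {w : ℝ → X} (hτ : 0 < τ) (hab : a ≤ b)
    (hc : c < a + τ)
    (hw : ∀ t, t ∉ Ioo b c → w t = 0) {t : ℝ} (ht : t ∈ Icc a (a + τ)) :
    timePeriodize a τ w t = w t := by
  rcases eq_or_lt_of_le ht.2 with h | h
  · rw [h, periodic_timePeriodize hτ w a, timePeriodize_eq_self hτ w ⟨le_rfl, by linarith⟩,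
      hw a fun hm => ?_, hw (a + τ) fun hm => ?_]
    · linarith [hm.2]
    · linarith [hm.1]
  · exact timePeriodize_eq_self hτ w ⟨ht.1, h⟩

end Periodize

/-! ## Periodisation of space–time fields on the torus -/

namespace Torus

variable {d : Type*} [Fintype d]
variable {F : Type*} [NormedAddCommGroup F] [NormedSpace ℝ F]
variable {a τ b c : ℝ} {w : ℝ → UnitAddTorus d → F}

/-- **Smoothness of the periodisation** (Cheskidov 2023, §6, p. 18: the periodised cut-off
density and drift are smooth). If `w` is jointly smooth on `ℝ × T^d` and vanishes for
`t ∉ (b, c)` with `a ≤ b`, `c < a + τ`, then `timePeriodize a τ w` is jointly smooth on `ℝ × T^d`. [cite: Cheskidov2023, §6 p. 18] -/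
theorem IsSmoothSpaceTimeOn.timePeriodize (hws : IsSmoothSpaceTimeOn univ w) (hτ : 0 < τ)
    (hab : a ≤ b) (hc : c < a + τ) (hw : ∀ t, t ∉ Ioo b c → w t = 0) :
    IsSmoothSpaceTimeOn univ (timePeriodize a τ w) := by
  have hws' : ContDiff ℝ ∞ (stLift w) := by
    rw [← contDiffOn_univ, ← univ_prod_univ]; exact hws
  rw [IsSmoothSpaceTimeOn, univ_prod_univ, contDiffOn_univ]
  refine contDiff_iff_contDiffAt.2 fun p => ?_
  obtain ⟨t₀, y⟩ := p
  have hsm : ContDiff ℝ ∞ (fun q : ℝ × EuclideanSpace ℝ d =>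
      stLift w (q.1 - (⌊(t₀ - a) / τ⌋ : ℝ) * τ, q.2)) :=
    hws'.comp ((contDiff_fst.sub contDiff_const).prodMk contDiff_snd)
  refine (hsm.contDiffAt (x := (t₀, y))).congr_of_eventuallyEq ?_
  have h := eventually_timePeriodize_eq_translate hτ hab hc hw t₀
  have h2 : ∀ᶠ q : ℝ × EuclideanSpace ℝ d in 𝓝 (t₀, y),
      FunctionSpaces.timePeriodize a τ w q.1 = w (q.1 - (⌊(t₀ - a) / τ⌋ : ℝ) * τ) :=
    (continuous_fst.tendsto (t₀, y)).eventually h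
  filter_upwards [h2] with q hq
  simp only [stLift]
  rw [hq]

omit [Fintype d] in
/-- **Time derivatives commute with periodisation** for fields supported in a compact
sub-window: `∂ₜ(timePeriodize a τ w) = timePeriodize a τ (∂ₜ w)` (both within `univ`). [folklore] -/
theorem timeDerivWithin_timePeriodize (hτ : 0 < τ) (hab : a ≤ b) (hc : c < a + τ)
    (hw : ∀ t, t ∉ Ioo b c → w t = 0) (t : ℝ) :
    timeDerivWithin univ (timePeriodize a τ w) t = timePeriodize a τ (timeDerivWithin univ w) t := by
  funext x
  have h := eventually_timePeriodize_eq_translate hτ hab hc hw t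
  have h' : (fun s => timePeriodize a τ w s x) =ᶠ[𝓝 t]
      fun s => w (s - (⌊(t - a) / τ⌋ : ℝ) * τ) x :=
    h.mono fun s hs => by simp only [hs]
  rw [timeDerivWithin, derivWithin_univ, h'.deriv_eq, timePeriodize_apply, timeDerivWithin,
    derivWithin_univ, deriv_comp_sub_const (fun s => w s x) ((⌊(t - a) / τ⌋ : ℝ) * τ) t]
  rfl

omit [Fintype d] in
/-- Two-sided form of `timeDerivWithin_timePeriodize`: `Torus.timeDeriv` (the two-sided time
derivative of `TorusCalculus`, used for test fields) also commutes with periodisation. The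
solution notions of the tree (`IsClassicalNSSolutionOn`, `IsClassicalScalarTransportOn`) and the
Cheskidov consumer use the within-`univ` form above; both agree (`derivWithin_univ`). [folklore] -/
theorem timeDeriv_timePeriodize (hτ : 0 < τ) (hab : a ≤ b) (hc : c < a + τ)
    (hw : ∀ t, t ∉ Ioo b c → w t = 0) (t : ℝ) :
    timeDeriv (timePeriodize a τ w) t = timePeriodize a τ (timeDeriv w) t := by
  have h1 : ∀ (u : ℝ → UnitAddTorus d → F) (s : ℝ), timeDeriv u s = timeDerivWithin univ u s := by
    intro u s; funext x; simp [timeDeriv, timeDerivWithin, derivWithin_univ]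
  have h2 : (timeDeriv w) = timeDerivWithin univ w := funext (h1 w)
  rw [h1, h2]
  exact timeDerivWithin_timePeriodize hτ hab hc hw t

/-! ## Smooth time cutoffs -/

/-- **Smooth time cutoff of a space–time field** (Cheskidov 2023, §6, p. 18: `η θ̃^m`,
`η̃ ṽ^m`). If `u` is jointly smooth on `S × T^d` and `χ ∈ C^∞(ℝ)` is supported in the interior
of `S` (`tsupport χ ⊆ interior S`), then `(t, x) ↦ χ(t) • u(t, x)` is jointly smooth on all of
`ℝ × T^d` (the junk values of `u` off `S` are killed by `χ`). [cite: Cheskidov2023, §6 p. 18] -/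
theorem IsSmoothSpaceTimeOn.cutoff {S : Set ℝ} {u : ℝ → UnitAddTorus d → F}
    (hu : IsSmoothSpaceTimeOn S u) {χ : ℝ → ℝ} (hχ : ContDiff ℝ ∞ χ)
    (hsupp : tsupport χ ⊆ interior S) :
    IsSmoothSpaceTimeOn univ (fun t x => χ t • u t x) := by
  rw [IsSmoothSpaceTimeOn, univ_prod_univ, contDiffOn_univ]
  refine contDiff_iff_contDiffAt.2 fun p => ?_
  obtain ⟨t₀, y⟩ := p
  by_cases ht : t₀ ∈ interior S
  · have hn : (interior S) ×ˢ (univ : Set (EuclideanSpace ℝ d)) ∈ 𝓝 (t₀, y) :=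
      prod_mem_nhds (isOpen_interior.mem_nhds ht) univ_mem
    have h1 : ContDiffAt ℝ ∞ (stLift u) (t₀, y) :=
      (hu.mono interior_subset).contDiffAt hn
    have h2 : ContDiffAt ℝ ∞ (fun q : ℝ × EuclideanSpace ℝ d => χ q.1) (t₀, y) :=
      (hχ.comp contDiff_fst).contDiffAt
    exact (h2.smul h1).congr_of_eventuallyEq (Eventually.of_forall fun q => rfl)
  · have ht' : t₀ ∉ tsupport χ := fun h => ht (hsupp h)
    have h0 : ∀ᶠ s in 𝓝 t₀, χ s = 0 := by
      have : (tsupport χ)ᶜ ∈ 𝓝 t₀ := (isClosed_tsupport χ).isOpen_compl.mem_nhds ht'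
      filter_upwards [this] with s hs using image_eq_zero_of_notMem_tsupport hs
    have h2 : ∀ᶠ q : ℝ × EuclideanSpace ℝ d in 𝓝 (t₀, y), χ q.1 = 0 :=
      (continuous_fst.tendsto (t₀, y)).eventually h0
    refine (contDiffAt_const (c := (0 : F))).congr_of_eventuallyEq ?_
    filter_upwards [h2] with q hq
    simp only [stLift, hq, zero_smul]

omit [Fintype d] in
/-- Values of the cut-off field: `χ(t) • u(t) = 0` where `χ(t) = 0` and `= u(t)` where `χ(t) = 1`. [folklore] -/
theorem cutoff_apply_of_eq_zero {u : ℝ → UnitAddTorus d → F} {χ : ℝ → ℝ} {t : ℝ} (h : χ t = 0) :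
    (fun x => χ t • u t x) = 0 := by
  funext x; simp [h]

omit [Fintype d] in
/-- Values of the cut-off field where the cutoff is `1`. [folklore] -/
theorem cutoff_apply_of_eq_one {u : ℝ → UnitAddTorus d → F} {χ : ℝ → ℝ} {t : ℝ} (h : χ t = 1) :
    (fun x => χ t • u t x) = u t := by
  funext x; simp [h]

end Torus

end Literature.Analysis.FunctionSpaces

end
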